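import Summits.BirchSwinnertonDyer.BirchSwinnertonDyer.Theorems.GenusKolyvaginAtTwoGenusPrimitiveSupplyAtTwoTwistingPrimeDepthOne
import HarnessLib

/-!
# Route `GenusKolyvaginAtTwo`, crux #2 `GenusPrimitiveSupplyAtTwo` (stmt-BirchSwinnertonDyer-22136):
# the unipotent quotient `Γ_{ℚ(E[2])}/Γ_{ℚ(E[4])} ≅ M₂(𝔽₂)` and `Hom_{GL₂(𝔽₂)}(M₂(𝔽₂), 𝔽₂²) = 𝔽₂`

Width seat `bsd-line-gk2-p4` g8, cell `bsd-f1-sign2`; helper (`--supports stmt-BirchSwinnertonDyer-22136`),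
tenth file of the twisting-prime series (after `…TwistingPrimeDepthOne`). THEOREMS ONLY: no definition, no
named fact, no `sorry`; no item is closed; BSD is not proved by any of this.

WHY. The depth-`2` capstone `exists_kolyvaginPrime_pow_genusPair_selmer_of_cor34i_of_half` (p620446) carries a
`W`-side hypothesis «some class of `Sel₂(W)` does not die on `Γ_{ℚ(E[4])}`». On the habitat (`ρ_{E,4}` onto,
`#Sel₂(W) = 4`) this is AUTOMATIC because the inflation kernel `Inf H¹(Gal(ℚ(E[4])/ℚ), E[2])` has at most
TWO elements (Lawson–Wuthrich: `H¹(GL₂(ℤ/4), 𝔽₂²) = 𝔽₂`). This file supplies the two ingredients; the sequel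
`…TwistingPrimeDepthTwoInflation` assembles them:

* §23 (finite computation, `decide` on `2 × 2` matrices over `𝔽₂`): an additive map `M₂(𝔽₂) → 𝔽₂²` equivariant
  for conjugation by `GL₂(𝔽₂)` is determined by its value on `E₁₁`, which is `0` or `(1,1)`; hence two NON-ZERO
  such maps coincide (`twoByTwo_equivariant_unique`; the `𝔽₂[S₃]`-module `M₂(𝔽₂) ≅ V ⊗ V ≅ V ⊕ P(1)`).
* §24 (Galois side, for `ρ_{E,4}` onto): the unipotent automorphisms `u_A : P ↦ P + A(2P)` of `E[4]`
  (`A ∈ End(E[2])`) are realised by Galois (`exists_smul_eq_add_apply_two_zsmul`), their realisations lie in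
  `Γ_{ℚ(E[2])}` and are unique modulo `Γ_{ℚ(E[4])}`, multiply like `A + B`, conjugate like `τAτ⁻¹`
  (`smul_eq_add_mul`, `smul_eq_add_conj`), and EVERY element of `Γ_{ℚ(E[2])}` is one of them
  (`exists_smul_eq_add_of_mem_torsionFixing_two`, via the `2`-divisibility of `E(ℚ̄)`): i.e.
  `Γ_{ℚ(E[2])}/Γ_{ℚ(E[4])} ≅ M₂(𝔽₂)` equivariantly, stated element-wise (no new definitions).

References: [LawsonWuthrich2016] §3; [Serre1972] §4; [GrossLMS1991] §9; [SilvermanAEC2009] III.7, VIII.2.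
-/

set_option linter.dupNamespace false -- tree convention: `Summit.BirchSwinnertonDyer.BirchSwinnertonDyer.Theorems` (summit = sub-problem)
set_option autoImplicit false

noncomputable section

open scoped Classical Pointwise

namespace Summit.BirchSwinnertonDyer.BirchSwinnertonDyer.Theorems.GenusKolyTwistingPrime

open WeierstrassCurve NumberField IsDedekindDomain Field
open Literature.NumberTheory.GaloisRepresentations Literature.NumberTheory.EllipticCurves
open Literature.NumberTheory Matrix

/-! ## §23 `Hom_{GL₂(𝔽₂)}(M₂(𝔽₂)^{conj}, 𝔽₂²) = 𝔽₂` (the finite computation) -/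

section TwoByTwo

/-- **`Hom_{GL₂(𝔽₂)}(M₂(𝔽₂)^{conj}, 𝔽₂²)`, step 1: an equivariant additive map vanishing on `E₁₁` vanishes.**
For `G : M₂(𝔽₂) →+ 𝔽₂²` with `G(g M g') = g·G(M)` whenever `g g' = 1`: the swap and the two shears give
`G(E₂₂) = s·G(E₁₁)`, `G(E₁₂) = t·G(E₁₁) − G(E₁₁)`, `G(E₂₁) = u·G(E₁₁) − G(E₁₁)`, and the `E_{ij}` span.
[folklore] -/
theorem twoByTwo_equivariant_eq_zero (G : Matrix (Fin 2) (Fin 2) (ZMod 2) →+ (Fin 2 → ZMod 2))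
    (hG : ∀ (g g' : Matrix (Fin 2) (Fin 2) (ZMod 2)) (M : Matrix (Fin 2) (Fin 2) (ZMod 2)), g * g' = 1 → G (g * M * g') = g *ᵥ G M)
    (h0 : G (Matrix.single 0 0 1) = 0) : G = 0 := by
  have hs : (!![0, 1; 1, 0] : Matrix (Fin 2) (Fin 2) (ZMod 2)) * !![0, 1; 1, 0] = 1 := by decide
  have ht : (!![1, 1; 0, 1] : Matrix (Fin 2) (Fin 2) (ZMod 2)) * !![1, 1; 0, 1] = 1 := by decide
  have hu : (!![1, 0; 1, 1] : Matrix (Fin 2) (Fin 2) (ZMod 2)) * !![1, 0; 1, 1] = 1 := by decide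
  have e1 : (!![0, 1; 1, 0] : Matrix (Fin 2) (Fin 2) (ZMod 2)) * Matrix.single 0 0 1 * !![0, 1; 1, 0] = Matrix.single 1 1 1 := by decide
  have e2 : (!![1, 1; 0, 1] : Matrix (Fin 2) (Fin 2) (ZMod 2)) * Matrix.single 0 0 1 * !![1, 1; 0, 1] =
      Matrix.single 0 0 1 + Matrix.single 0 1 1 := by decide
  have e3 : (!![1, 0; 1, 1] : Matrix (Fin 2) (Fin 2) (ZMod 2)) * Matrix.single 0 0 1 * !![1, 0; 1, 1] =
      Matrix.single 0 0 1 + Matrix.single 1 0 1 := by decide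
  have R1 : G (Matrix.single 1 1 1) = 0 := by
    rw [← e1, hG _ _ _ hs, h0, Matrix.mulVec_zero]
  have R2 : G (Matrix.single 0 1 1) = 0 := by
    have h := hG _ _ (Matrix.single 0 0 1) ht
    rw [e2, map_add, h0, Matrix.mulVec_zero, zero_add] at h
    exact h
  have R3 : G (Matrix.single 1 0 1) = 0 := by
    have h := hG _ _ (Matrix.single 0 0 1) hu
    rw [e3, map_add, h0, Matrix.mulVec_zero, zero_add] at h
    exact h
  have hall : ∀ i j : Fin 2, G (Matrix.single i j 1) = 0 := by
    intro i j
    fin_cases i <;> fin_cases j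
    · exact h0
    · exact R2
    · exact R3
    · exact R1
  ext M : 1
  rw [AddMonoidHom.zero_apply, Matrix.matrix_eq_sum_single M, map_sum]
  refine Finset.sum_eq_zero fun i _ ↦ ?_
  rw [map_sum]
  refine Finset.sum_eq_zero fun j _ ↦ ?_
  have hc : M i j = 0 ∨ M i j = 1 := by generalize M i j = c; revert c; decide
  rcases hc with hc | hc
  · rw [hc, Matrix.single_zero, map_zero]
  · rw [hc, hall]

/-- **Step 2: the value on `E₁₁` is `0` or `(1,1)`** (compare the two expressions for `G(E₂₁)` obtained from
the shear `u` and from the swap applied to `G(E₁₂)`). [folklore] -/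
theorem twoByTwo_equivariant_apply_single (G : Matrix (Fin 2) (Fin 2) (ZMod 2) →+ (Fin 2 → ZMod 2))
    (hG : ∀ (g g' : Matrix (Fin 2) (Fin 2) (ZMod 2)) (M : Matrix (Fin 2) (Fin 2) (ZMod 2)), g * g' = 1 → G (g * M * g') = g *ᵥ G M) :
    G (Matrix.single 0 0 1) = 0 ∨ G (Matrix.single 0 0 1) = ![1, 1] := by
  have hs : (!![0, 1; 1, 0] : Matrix (Fin 2) (Fin 2) (ZMod 2)) * !![0, 1; 1, 0] = 1 := by decide
  have ht : (!![1, 1; 0, 1] : Matrix (Fin 2) (Fin 2) (ZMod 2)) * !![1, 1; 0, 1] = 1 := by decide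
  have hu : (!![1, 0; 1, 1] : Matrix (Fin 2) (Fin 2) (ZMod 2)) * !![1, 0; 1, 1] = 1 := by decide
  have e2 : (!![1, 1; 0, 1] : Matrix (Fin 2) (Fin 2) (ZMod 2)) * Matrix.single 0 0 1 * !![1, 1; 0, 1] =
      Matrix.single 0 0 1 + Matrix.single 0 1 1 := by decide
  have e3 : (!![1, 0; 1, 1] : Matrix (Fin 2) (Fin 2) (ZMod 2)) * Matrix.single 0 0 1 * !![1, 0; 1, 1] =
      Matrix.single 0 0 1 + Matrix.single 1 0 1 := by decide
  have e4 : (!![0, 1; 1, 0] : Matrix (Fin 2) (Fin 2) (ZMod 2)) * Matrix.single 0 1 1 * !![0, 1; 1, 0] = Matrix.single 1 0 1 := by decide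
  set w := G (Matrix.single 0 0 1) with hw
  have R2 : G (Matrix.single 0 1 1) = !![1, 1; 0, 1] *ᵥ w - w := by
    have h := hG _ _ (Matrix.single 0 0 1) ht
    rw [e2, map_add] at h
    exact eq_sub_of_add_eq' h
  have R3 : G (Matrix.single 1 0 1) = !![1, 0; 1, 1] *ᵥ w - w := by
    have h := hG _ _ (Matrix.single 0 0 1) hu
    rw [e3, map_add] at h
    exact eq_sub_of_add_eq' h
  have R4 : G (Matrix.single 1 0 1) = !![0, 1; 1, 0] *ᵥ G (Matrix.single 0 1 1) := by
    rw [← e4, hG _ _ _ hs]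
  have key : ∀ v : Fin 2 → ZMod 2,
      (!![1, 0; 1, 1] : Matrix (Fin 2) (Fin 2) (ZMod 2)) *ᵥ v - v = (!![0, 1; 1, 0] : Matrix (Fin 2) (Fin 2) (ZMod 2)) *ᵥ ((!![1, 1; 0, 1] : Matrix (Fin 2) (Fin 2) (ZMod 2)) *ᵥ v - v) →
      v = 0 ∨ v = ![1, 1] := by decide
  exact key w (by rw [← R3, R4, R2])

/-- **`Hom_{GL₂(𝔽₂)}(M₂(𝔽₂)^{conj}, 𝔽₂²) = 𝔽₂`**: two NON-ZERO additive maps `M₂(𝔽₂) → 𝔽₂²` equivariant for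
conjugation by `GL₂(𝔽₂) = SL₂(𝔽₂)` coincide (the `𝔽₂[S₃]`-module `M₂(𝔽₂) ≅ V ⊗ V ≅ V ⊕ P(1)` has a unique
non-zero map to `V`). This is the computation behind `H¹(GL₂(ℤ/4), 𝔽₂²) = 𝔽₂` (Lawson–Wuthrich): at most
ONE non-zero class of `H¹(ℚ, E[2])` is inflated from `ℚ(E[4])`. [cite: LawsonWuthrich2016, §3 (Lemma 6 and the case p = 2)] -/
theorem twoByTwo_equivariant_unique (F F' : Matrix (Fin 2) (Fin 2) (ZMod 2) →+ (Fin 2 → ZMod 2))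
    (hF : ∀ (g g' : Matrix (Fin 2) (Fin 2) (ZMod 2)) (M : Matrix (Fin 2) (Fin 2) (ZMod 2)), g * g' = 1 → F (g * M * g') = g *ᵥ F M)
    (hF' : ∀ (g g' : Matrix (Fin 2) (Fin 2) (ZMod 2)) (M : Matrix (Fin 2) (Fin 2) (ZMod 2)), g * g' = 1 → F' (g * M * g') = g *ᵥ F' M)
    (h0 : F ≠ 0) (h0' : F' ≠ 0) : F = F' := by
  have hw : F (Matrix.single 0 0 1) = ![1, 1] := by
    rcases twoByTwo_equivariant_apply_single F hF with h | h
    · exact absurd (twoByTwo_equivariant_eq_zero F hF h) h0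
    · exact h
  have hw' : F' (Matrix.single 0 0 1) = ![1, 1] := by
    rcases twoByTwo_equivariant_apply_single F' hF' with h | h
    · exact absurd (twoByTwo_equivariant_eq_zero F' hF' h) h0'
    · exact h
  have hD : ∀ (g g' : Matrix (Fin 2) (Fin 2) (ZMod 2)) (M : Matrix (Fin 2) (Fin 2) (ZMod 2)), g * g' = 1 → (F - F') (g * M * g') = g *ᵥ (F - F') M := by
    intro g g' M hgg
    rw [AddMonoidHom.sub_apply, AddMonoidHom.sub_apply, hF g g' M hgg, hF' g g' M hgg, Matrix.mulVec_sub]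
  have h := twoByTwo_equivariant_eq_zero (F - F') hD (by rw [AddMonoidHom.sub_apply, hw, hw', sub_self])
  exact sub_eq_zero.mp h

end TwoByTwo


/-! ## §24 The unipotents `u_A` of `E[4]` and their Galois realisations -/

section InflationFour

variable (W : WeierstrassCurve ℚ)

/-- `2P ∈ E[2]` for `P ∈ E[4]`. [folklore] -/
theorem two_zsmul_mem_geomTorsion_two (P : geomTorsion W (4 : ℤ)) :
    (2 : ℤ) • (P : geomPoints W) ∈ geomTorsion W (2 : ℤ) := by
  rw [WeierstrassCurve.mem_geomTorsion_iff, smul_smul]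
  exact (WeierstrassCurve.mem_geomTorsion_iff W (4 : ℤ) _).mp P.2

/-- Elements of `E[4]` killed by `2` come from `E[2]`, hence are fixed by `Γ_{ℚ(E[2])}`. [folklore] -/
theorem smul_eq_self_of_two_zsmul_eq_zero {ρ : absoluteGaloisGroup ℚ} (hρ : ρ ∈ torsionFixing W (2 : ℤ))
    {P : geomPoints W} (hP : (2 : ℤ) • P = 0) : ρ • P = P := by
  have hmem : P ∈ geomTorsion W (2 : ℤ) := (WeierstrassCurve.mem_geomTorsion_iff W 2 P).mpr hP
  have h := smul_eq_of_mem_torsionFixing W (2 : ℤ) hρ ⟨P, hmem⟩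
  exact congrArg (fun x : geomTorsion W (2 : ℤ) ↦ (x : geomPoints W)) h

/-- `v + v = 0` on `E[2]` (in `E(ℚ̄)`). [folklore] -/
theorem coe_add_self_geomTorsion_two (v : geomTorsion W (2 : ℤ)) : (v : geomPoints W) + v = 0 := by
  rw [← two_zsmul]; exact (WeierstrassCurve.mem_geomTorsion_iff W 2 _).mp v.2

/-- **The unipotent automorphisms `u_A : P ↦ P + A(2P)` of `E[4]` are realised by Galois** when
`ρ_{E,4}` is onto: for every additive `A : E[2] → E[2]` there is `σ ∈ Γ_ℚ` with `σP = P + A(2P)` on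
`E[4]` (`u_A` is an involution of `E[4]`, trivial on `E[2]` and on `E[4]/E[2]`; these are the elements
`1 + 2X` of `ker(GL₂(ℤ/4) → GL₂(ℤ/2)) ≅ M₂(𝔽₂)`). [cite: LawsonWuthrich2016, §3] [cite: Serre1972, §4] -/
theorem exists_smul_eq_add_apply_two_zsmul (hsurj4 : W.HasSurjectiveModNGaloisRep 4)
    (A : geomTorsion W (2 : ℤ) →+ geomTorsion W (2 : ℤ)) :
    ∃ σ : absoluteGaloisGroup ℚ, ∀ P : geomTorsion W (4 : ℤ),
      ((σ • P : geomTorsion W (4 : ℤ)) : geomPoints W) =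
        (P : geomPoints W) + (A ⟨(2 : ℤ) • (P : geomPoints W), two_zsmul_mem_geomTorsion_two W P⟩ : geomPoints W) := by
  have h24 : geomTorsion W (2 : ℤ) ≤ geomTorsion W (4 : ℤ) := W.geomTorsion_le_of_dvd (by norm_num)
  -- the map `P ↦ A(2P)` as an additive map `E[4] → E[4]`
  let N : geomTorsion W (4 : ℤ) →+ geomTorsion W (4 : ℤ) :=
    { toFun := fun P ↦ AddSubgroup.inclusion h24 (A ⟨(2 : ℤ) • (P : geomPoints W), two_zsmul_mem_geomTorsion_two W P⟩)
      map_zero' := by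
        have h0 : (⟨(2 : ℤ) • ((0 : geomTorsion W (4 : ℤ)) : geomPoints W), two_zsmul_mem_geomTorsion_two W 0⟩ :
            geomTorsion W (2 : ℤ)) = 0 := Subtype.ext (by simp)
        rw [h0, map_zero, map_zero]
      map_add' := fun P Q ↦ by
        have h : (⟨(2 : ℤ) • ((P + Q : geomTorsion W (4 : ℤ)) : geomPoints W), two_zsmul_mem_geomTorsion_two W (P + Q)⟩ :
            geomTorsion W (2 : ℤ)) =
            ⟨(2 : ℤ) • (P : geomPoints W), two_zsmul_mem_geomTorsion_two W P⟩ +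
              ⟨(2 : ℤ) • (Q : geomPoints W), two_zsmul_mem_geomTorsion_two W Q⟩ :=
          Subtype.ext (by simp)
        rw [h, map_add, map_add] }
  have hN : ∀ P : geomTorsion W (4 : ℤ), (N P : geomPoints W) =
      (A ⟨(2 : ℤ) • (P : geomPoints W), two_zsmul_mem_geomTorsion_two W P⟩ : geomPoints W) := fun P ↦ rfl
  -- `N (N P) = 0`-type facts: `N` kills `E[2]`-valued points, and `N P + N P = 0`
  have hN2 : ∀ P : geomTorsion W (4 : ℤ), (2 : ℤ) • (P : geomPoints W) = 0 → N P = 0 := by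
    intro P hP
    apply Subtype.ext
    rw [hN]
    have h0 : (⟨(2 : ℤ) • (P : geomPoints W), two_zsmul_mem_geomTorsion_two W P⟩ : geomTorsion W (2 : ℤ)) = 0 :=
      Subtype.ext hP
    rw [h0, map_zero]; rfl
  have hNN : ∀ P : geomTorsion W (4 : ℤ), N (N P) = 0 := fun P ↦
    hN2 (N P) ((WeierstrassCurve.mem_geomTorsion_iff W 2 _).mp (A _).2)
  have hNself : ∀ P : geomTorsion W (4 : ℤ), N P + N P = 0 := fun P ↦
    Subtype.ext (by rw [AddSubgroup.coe_add, hN]; exact coe_add_self_geomTorsion_two W _)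
  -- the involution `u_A = 1 + N`
  let u : geomTorsion W (4 : ℤ) ≃+ geomTorsion W (4 : ℤ) :=
    { toFun := fun P ↦ P + N P
      invFun := fun P ↦ P + N P
      left_inv := fun P ↦ by
        simp only [map_add, hNN, add_zero]
        rw [add_assoc, hNself, add_zero]
      right_inv := fun P ↦ by
        simp only [map_add, hNN, add_zero]
        rw [add_assoc, hNself, add_zero]
      map_add' := fun P Q ↦ by rw [map_add]; abel }
  obtain ⟨σ, hσ⟩ := hsurj4 (Multiplicative.ofAdd u)
  refine ⟨σ, fun P ↦ ?_⟩
  have h := galoisRepTorsion_apply W (4 : ℤ) σ P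
  rw [hσ, toAdd_ofAdd] at h
  rw [← h]
  change ((P + N P : geomTorsion W (4 : ℤ)) : geomPoints W) = _
  rw [AddSubgroup.coe_add, hN]

/-- If `σ` acts on `E[4]` as `u_A : P ↦ P + A(2P)` then `σ ∈ Γ_{ℚ(E[2])}` (`u_A` is trivial on `E[2]`).
[folklore] -/
theorem mem_torsionFixing_two_of_smul_eq_add (A : geomTorsion W (2 : ℤ) →+ geomTorsion W (2 : ℤ))
    {σ : absoluteGaloisGroup ℚ}
    (hσ : ∀ P : geomTorsion W (4 : ℤ), ((σ • P : geomTorsion W (4 : ℤ)) : geomPoints W) =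
      (P : geomPoints W) + (A ⟨(2 : ℤ) • (P : geomPoints W), two_zsmul_mem_geomTorsion_two W P⟩ : geomPoints W)) :
    σ ∈ torsionFixing W (2 : ℤ) := by
  have h24 : geomTorsion W (2 : ℤ) ≤ geomTorsion W (4 : ℤ) := W.geomTorsion_le_of_dvd (by norm_num)
  rw [mem_torsionFixing_iff]
  intro v
  apply Subtype.ext
  have h := hσ (AddSubgroup.inclusion h24 v)
  have h0 : (⟨(2 : ℤ) • ((AddSubgroup.inclusion h24 v : geomTorsion W (4 : ℤ)) : geomPoints W),
      two_zsmul_mem_geomTorsion_two W _⟩ : geomTorsion W (2 : ℤ)) = 0 :=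
    Subtype.ext ((WeierstrassCurve.mem_geomTorsion_iff W 2 _).mp v.2)
  rw [h0, map_zero, AddSubgroup.coe_zero, add_zero] at h
  exact h

/-- Two elements acting on `E[4]` as the same `u_A` differ by an element of `Γ_{ℚ(E[4])}`. [folklore] -/
theorem mul_inv_mem_torsionFixing_four_of_smul_eq_add (A : geomTorsion W (2 : ℤ) →+ geomTorsion W (2 : ℤ))
    {σ ρ : absoluteGaloisGroup ℚ}
    (hσ : ∀ P : geomTorsion W (4 : ℤ), ((σ • P : geomTorsion W (4 : ℤ)) : geomPoints W) =
      (P : geomPoints W) + (A ⟨(2 : ℤ) • (P : geomPoints W), two_zsmul_mem_geomTorsion_two W P⟩ : geomPoints W))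
    (hρ : ∀ P : geomTorsion W (4 : ℤ), ((ρ • P : geomTorsion W (4 : ℤ)) : geomPoints W) =
      (P : geomPoints W) + (A ⟨(2 : ℤ) • (P : geomPoints W), two_zsmul_mem_geomTorsion_two W P⟩ : geomPoints W)) :
    ρ * σ⁻¹ ∈ torsionFixing W (4 : ℤ) := by
  rw [mem_torsionFixing_iff]
  intro P
  apply Subtype.ext
  set Q : geomTorsion W (4 : ℤ) := σ⁻¹ • P with hQ
  have hPQ : σ • Q = P := by rw [hQ, smul_inv_smul]
  -- `2Q = 2P`, so `A(2Q) = A(2P) =: a`, `P = Q + a`, `ρQ = Q + a = P + a + a = P`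
  -- `σQ = P` reads `P = Q + A(2Q)`, and `ρQ = Q + A(2Q)`; hence `ρσ⁻¹P = ρQ = P`
  have hσQ := hσ Q
  rw [hPQ] at hσQ
  have hρQ := hρ Q
  rw [mul_smul, ← hQ]
  change ((ρ • Q : geomTorsion W (4 : ℤ)) : geomPoints W) = (P : geomPoints W)
  rw [hρQ, hσQ]

/-- `u_A ∘ u_B = u_{A+B}` on `E[4]`: products of realisations realise sums. [folklore] -/
theorem smul_eq_add_mul (A B : geomTorsion W (2 : ℤ) →+ geomTorsion W (2 : ℤ)) {σ τ : absoluteGaloisGroup ℚ}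
    (hσ : ∀ P : geomTorsion W (4 : ℤ), ((σ • P : geomTorsion W (4 : ℤ)) : geomPoints W) =
      (P : geomPoints W) + (A ⟨(2 : ℤ) • (P : geomPoints W), two_zsmul_mem_geomTorsion_two W P⟩ : geomPoints W))
    (hτ : ∀ P : geomTorsion W (4 : ℤ), ((τ • P : geomTorsion W (4 : ℤ)) : geomPoints W) =
      (P : geomPoints W) + (B ⟨(2 : ℤ) • (P : geomPoints W), two_zsmul_mem_geomTorsion_two W P⟩ : geomPoints W)) :
    ∀ P : geomTorsion W (4 : ℤ), (((σ * τ) • P : geomTorsion W (4 : ℤ)) : geomPoints W) =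
      (P : geomPoints W) + ((A + B) ⟨(2 : ℤ) • (P : geomPoints W), two_zsmul_mem_geomTorsion_two W P⟩ : geomPoints W) := by
  intro P
  set R : geomTorsion W (4 : ℤ) := τ • P with hR
  have hRv : (R : geomPoints W) = (P : geomPoints W) +
      (B ⟨(2 : ℤ) • (P : geomPoints W), two_zsmul_mem_geomTorsion_two W P⟩ : geomPoints W) := hτ P
  have hb2 : (2 : ℤ) • ((B ⟨(2 : ℤ) • (P : geomPoints W), two_zsmul_mem_geomTorsion_two W P⟩ : geomTorsion W (2 : ℤ)) :
      geomPoints W) = 0 := (WeierstrassCurve.mem_geomTorsion_iff W 2 _).mp (B _).2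
  have h2R : (⟨(2 : ℤ) • (R : geomPoints W), two_zsmul_mem_geomTorsion_two W R⟩ : geomTorsion W (2 : ℤ)) =
      ⟨(2 : ℤ) • (P : geomPoints W), two_zsmul_mem_geomTorsion_two W P⟩ :=
    Subtype.ext (by change (2 : ℤ) • (R : geomPoints W) = (2 : ℤ) • (P : geomPoints W); rw [hRv, zsmul_add, hb2, add_zero])
  rw [mul_smul, ← hR, hσ R, h2R, hRv, AddMonoidHom.add_apply, AddSubgroup.coe_add]
  abel

/-- Conjugating a realisation of `u_A` by `τ ∈ Γ_ℚ` realises `u_{τAτ⁻¹}`. [folklore] -/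
theorem smul_eq_add_conj (A : geomTorsion W (2 : ℤ) →+ geomTorsion W (2 : ℤ)) {σ : absoluteGaloisGroup ℚ}
    (hσ : ∀ P : geomTorsion W (4 : ℤ), ((σ • P : geomTorsion W (4 : ℤ)) : geomPoints W) =
      (P : geomPoints W) + (A ⟨(2 : ℤ) • (P : geomPoints W), two_zsmul_mem_geomTorsion_two W P⟩ : geomPoints W))
    (τ : absoluteGaloisGroup ℚ) :
    ∀ P : geomTorsion W (4 : ℤ), (((τ * σ * τ⁻¹) • P : geomTorsion W (4 : ℤ)) : geomPoints W) =
      (P : geomPoints W) +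
        (((DistribSMul.toAddMonoidHom (geomTorsion W (2 : ℤ)) τ).comp
            (A.comp (DistribSMul.toAddMonoidHom (geomTorsion W (2 : ℤ)) τ⁻¹)))
          ⟨(2 : ℤ) • (P : geomPoints W), two_zsmul_mem_geomTorsion_two W P⟩ : geomPoints W) := by
  intro P
  set R : geomTorsion W (4 : ℤ) := τ⁻¹ • P with hR
  have hRv : (R : geomPoints W) = τ⁻¹ • (P : geomPoints W) := rfl
  have h2R : (⟨(2 : ℤ) • (R : geomPoints W), two_zsmul_mem_geomTorsion_two W R⟩ : geomTorsion W (2 : ℤ)) =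
      τ⁻¹ • ⟨(2 : ℤ) • (P : geomPoints W), two_zsmul_mem_geomTorsion_two W P⟩ :=
    Subtype.ext (by
      change (2 : ℤ) • (R : geomPoints W) = τ⁻¹ • ((2 : ℤ) • (P : geomPoints W))
      rw [hRv, WeierstrassCurve.smul_zsmul_geomPoints])
  rw [mul_smul, mul_smul, ← hR]
  change τ • ((σ • R : geomTorsion W (4 : ℤ)) : geomPoints W) = _
  rw [hσ R, smul_add, h2R, hRv, smul_inv_smul, AddMonoidHom.comp_apply, AddMonoidHom.comp_apply,
    DistribSMul.toAddMonoidHom_apply, DistribSMul.toAddMonoidHom_apply]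
  rfl

/-- **Every `ρ ∈ Γ_{ℚ(E[2])}` acts on `E[4]` as some `u_A`** (`A(2P) := ρP − P`, well defined because
`ρ` fixes `E[2] = ker(2 : E[4] → E[2])`; uses the `2`-divisibility of `E(ℚ̄)`). [folklore] -/
theorem exists_smul_eq_add_of_mem_torsionFixing_two {ρ : absoluteGaloisGroup ℚ}
    (hρ : ρ ∈ torsionFixing W (2 : ℤ)) :
    ∃ A : geomTorsion W (2 : ℤ) →+ geomTorsion W (2 : ℤ), ∀ P : geomTorsion W (4 : ℤ),
      ((ρ • P : geomTorsion W (4 : ℤ)) : geomPoints W) =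
        (P : geomPoints W) + (A ⟨(2 : ℤ) • (P : geomPoints W), two_zsmul_mem_geomTorsion_two W P⟩ : geomPoints W) := by
  have hdiv := W.zsmul_geomPoints_surjective_of_charZero (n := (2 : ℤ)) two_ne_zero
  choose half hhalf using fun v : geomTorsion W (2 : ℤ) ↦ hdiv (v : geomPoints W)
  -- `hhalf v : 2 • half v = v`
  have hfix : ∀ Q : geomPoints W, (2 : ℤ) • Q = 0 → ρ • Q = Q := fun Q hQ ↦
    smul_eq_self_of_two_zsmul_eq_zero W hρ hQ
  have hfix' : ∀ Q : geomPoints W, (2 : ℤ) • Q = 0 → ρ • Q - Q = 0 := fun Q hQ ↦ by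
    rw [hfix Q hQ, sub_self]
  have hhalf' : ∀ v : geomTorsion W (2 : ℤ), (2 : ℤ) • half v = (v : geomPoints W) := fun v ↦ hhalf v
  have hmem : ∀ v : geomTorsion W (2 : ℤ), ρ • half v - half v ∈ geomTorsion W (2 : ℤ) := by
    intro v
    rw [WeierstrassCurve.mem_geomTorsion_iff, zsmul_sub, ← WeierstrassCurve.smul_zsmul_geomPoints, hhalf',
      sub_eq_zero]
    exact congrArg (fun x : geomTorsion W (2 : ℤ) ↦ (x : geomPoints W)) (smul_eq_of_mem_torsionFixing W (2 : ℤ) hρ v)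
  -- `(ρ - 1)` is additive and kills `E[2]`
  have hlin : ∀ Q Q' : geomPoints W, ρ • (Q + Q') - (Q + Q') = (ρ • Q - Q) + (ρ • Q' - Q') := fun Q Q' ↦ by
    rw [smul_add]; abel
  have hkill : ∀ Q Q' : geomPoints W, (2 : ℤ) • Q = (2 : ℤ) • Q' → ρ • Q - Q = ρ • Q' - Q' := by
    intro Q Q' hQQ'
    have h0 : ρ • (Q - Q') - (Q - Q') = 0 := hfix' (Q - Q') (by rw [zsmul_sub, hQQ', sub_self])
    have h1 : ρ • (Q - Q') - (Q - Q') = (ρ • Q - Q) - (ρ • Q' - Q') := by rw [smul_sub]; abel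
    rw [h1] at h0
    exact sub_eq_zero.mp h0
  let A : geomTorsion W (2 : ℤ) →+ geomTorsion W (2 : ℤ) :=
    { toFun := fun v ↦ ⟨ρ • half v - half v, hmem v⟩
      map_zero' := Subtype.ext (hfix' (half 0) (by rw [hhalf']; rfl))
      map_add' := fun v w ↦ Subtype.ext (by
        change ρ • half (v + w) - half (v + w) = (ρ • half v - half v) + (ρ • half w - half w)
        rw [← hlin]
        apply hkill
        rw [hhalf', zsmul_add, hhalf', hhalf']
        rfl) }
  refine ⟨A, fun P ↦ ?_⟩
  change ρ • (P : geomPoints W) = (P : geomPoints W) + (ρ • half _ - half _)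
  have h := hkill (P : geomPoints W) (half ⟨(2 : ℤ) • (P : geomPoints W), two_zsmul_mem_geomTorsion_two W P⟩)
    (by rw [hhalf'])
  rw [← h, add_sub_cancel]

end InflationFour

end Summit.BirchSwinnertonDyer.BirchSwinnertonDyer.Theorems.GenusKolyTwistingPrime

end
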